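import Summits.NavierStokesRegularity.FunctionalMining.StrainFlat
import Summits.NavierStokesRegularity.FunctionalMining.StrainL4Pointwise
import Summits.NavierStokesRegularity.FunctionalMining.StrainCZ
import Summits.NavierStokesRegularity.FunctionalMining.VelocityMomentProduction
import Literature.Analysis.FluidPDE.TorusNSPressureGradientBudget
import HarnessLib

/-!
# FunctionalMining — static inputs for the strain moments `∫|S|^q` at a real exponent `q > 2`

Search for candidate a priori estimates; no regularity claim. Cell `pub-nsfunc`, prove seat
(gen 10). The static half of the K0 rows `ES.absS.q|T_LD|G1` at a REAL exponent (SIEVELD §3.3),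
the strain twin of `VorticityMomentHolder` (§3.2): with `φ = |S| = ‖strainFlat v‖` (so
`(|S|²)^r = φ^{2r}`), `g = ∑ₖ‖∂ₖv‖²`, `h = ∑ᵢⱼ|∂ᵢ∂ⱼp|`, `N = ∑ᵢⱼSᵢⱼ∑ₖ(∂ᵢv)ₖ(∂ₖv)ⱼ`,
`Π = ∑ᵢⱼSᵢⱼ∂ᵢ∂ⱼp`:

1. `|∫(|S|²)^{q/2−1}N| ≤ ∫ φ^{q−1} g` and `|∫(|S|²)^{q/2−1}Π| ≤ ∫ φ^{q−1} h` (pointwise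
   `|N| ≤ φ g`, `|Π| ≤ φ h`, `StrainL4Pointwise`);
2. Hölder `∫ φ^{q−1} G ≤ (∫φ^q)^{(q−1)/q} (∫G^q)^{1/q}`;
3. Calderón–Zygmund at `s = 2q` in real-power form: `∫ g^q ≤ K ∫ φ^{2q}` on `T³` (`StrainCZ`,
   Miller 2019 §3), and for the pressure Hessian along solutions `∫|∂ᵢ∂ⱼp|^q ≤ C ∫ g^q`
   (Robinson–Rodrigo–Sadowski Thm B.7) with the power mean `∫ h^q ≤ (#d²)^{q−1} ∑ᵢⱼ∫|∂ᵢ∂ⱼp|^q`;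
4. Cauchy–Schwarz `(∫φ^{2q})² ≤ (∫φ^q)(∫φ^{3q})` and the outward interpolation
   `∫φ^q ≤ (∫φ²)^θ (∫φ^{3q})^{1−θ}`, `θ = 2q/(3q−2)` — both for any continuous field.
-/

noncomputable section

open MeasureTheory Finset Set Filter Topology
open scoped InnerProductSpace RealInnerProductSpace ContDiff

namespace Summit.NavierStokesRegularity.FunctionalMining

open Literature.Analysis.FunctionSpaces Literature.Analysis.FunctionSpaces.Torus
  Literature.Analysis.FluidPDE

namespace StrainMoment

open StrainL4 NonlinearPoincare

variable {d : Type*} [Fintype d] [DecidableEq d]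

/-! ## 0. `(|S|²)^r = φ^{2r}` and continuity -/

/-- `(|S|²)^r = ‖strainFlat v x‖^{2r}`. [ours] -/
theorem strainSqAt_rpow_eq (v : UnitAddTorus d → EuclideanSpace ℝ d) (x : UnitAddTorus d) (r : ℝ) :
    torusStrainSqAt v x ^ r = ‖strainFlat v x‖ ^ (2 * r) := by
  rw [← norm_strainFlat_sq, ← Real.rpow_natCast, ← Real.rpow_mul (norm_nonneg _)]
  norm_num

/-! ## 1. The two productions against `φ^{q−1}` -/

/-- Pointwise: `(|S|²)^{q/2−1} · (φ B) = φ^{q−1} B` for `q ≥ 2`, `φ = ‖strainFlat v x‖`. [ours] -/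
theorem strainSqAt_rpow_mul_norm_mul (v : UnitAddTorus d → EuclideanSpace ℝ d) (x : UnitAddTorus d)
    {q : ℝ} (hq : 2 ≤ q) (B : ℝ) :
    torusStrainSqAt v x ^ (q / 2 - 1) * (‖strainFlat v x‖ * B) = ‖strainFlat v x‖ ^ (q - 1) * B := by
  rw [strainSqAt_rpow_eq]
  have hn : 0 ≤ ‖strainFlat v x‖ := norm_nonneg _
  have e2 : ‖strainFlat v x‖ ^ (2 * (q / 2 - 1)) * ‖strainFlat v x‖ = ‖strainFlat v x‖ ^ (q - 1) := by
    rcases eq_or_lt_of_le hn with hz | hpos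
    · rw [← hz, mul_zero, Real.zero_rpow (by linarith)]
    · rw [show q - 1 = 2 * (q / 2 - 1) + 1 by ring, Real.rpow_add hpos, Real.rpow_one]
  rw [← mul_assoc, e2]

/-- **Productions against the weight `(|S|²)^{q/2−1}`**: if `|D(x)| ≤ φ(x) B(x)` pointwise with
`B ≥ 0` continuous, then `|∫(|S|²)^{q/2−1} D| ≤ ∫ φ^{q−1} B` (`q ≥ 2`). [ours] -/
theorem abs_integral_rpow_mul_le {v : UnitAddTorus d → EuclideanSpace ℝ d} (hv : IsSmooth v)
    {D B : UnitAddTorus d → ℝ} (hB : Continuous B)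
    (hDB : ∀ x, |D x| ≤ Real.sqrt (torusStrainSqAt v x) * B x) {q : ℝ} (hq : 2 ≤ q) :
    |∫ x, torusStrainSqAt v x ^ (q / 2 - 1) * D x| ≤
      ∫ x, ‖strainFlat v x‖ ^ (q - 1) * B x := by
  have hpt : ∀ x, |torusStrainSqAt v x ^ (q / 2 - 1) * D x| ≤ ‖strainFlat v x‖ ^ (q - 1) * B x := by
    intro x
    have hQ0 : 0 ≤ torusStrainSqAt v x := torusStrainSqAt_nonneg v x
    rw [abs_mul, abs_of_nonneg (Real.rpow_nonneg hQ0 _), ← strainSqAt_rpow_mul_norm_mul v x hq,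
      norm_strainFlat_eq_sqrt]
    exact mul_le_mul_of_nonneg_left (hDB x) (Real.rpow_nonneg hQ0 _)
  have hc : Continuous fun x => ‖strainFlat v x‖ ^ (q - 1) * B x :=
    (VelocityMoment.continuous_norm_rpow' (continuous_strainFlat hv) (by linarith)).mul hB
  calc |∫ x, torusStrainSqAt v x ^ (q / 2 - 1) * D x|
      ≤ ∫ x, |torusStrainSqAt v x ^ (q / 2 - 1) * D x| := abs_integral_le_integral_abs
    _ ≤ ∫ x, ‖strainFlat v x‖ ^ (q - 1) * B x :=
        integral_mono_of_nonneg (ae_of_all _ fun x => abs_nonneg _) hc.integrable_unitAddTorus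
          (ae_of_all _ hpt)

/-- **`|X_N| ≤ ∫ φ^{q−1} g`** for the nonlinear production `X_N = ∫(|S|²)^{q/2−1}N`,
`N = ∑ᵢⱼ Sᵢⱼ ∑ₖ(∂ᵢv)ₖ(∂ₖv)ⱼ`, `g = ∑ₖ‖∂ₖv‖²`, real `q ≥ 2`. [ours] -/
theorem abs_nonlinear_production_le {v : UnitAddTorus d → EuclideanSpace ℝ d} (hv : IsSmooth v)
    {q : ℝ} (hq : 2 ≤ q) :
    |∫ x, torusStrainSqAt v x ^ (q / 2 - 1) * ∑ i, ∑ j,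
        (partialDeriv j v x i + partialDeriv i v x j) / 2 *
          ∑ k, partialDeriv i v x k * partialDeriv k v x j| ≤
      ∫ x, ‖strainFlat v x‖ ^ (q - 1) * ∑ k, ‖partialDeriv k v x‖ ^ 2 :=
  abs_integral_rpow_mul_le hv (VorticityL4.continuous_gradSq hv) (abs_nonlinearDensity_le v) hq

/-- **`|X_P| ≤ ∫ φ^{q−1} h`** for the pressure production `X_P = ∫(|S|²)^{q/2−1}∑ᵢⱼSᵢⱼ∂ᵢ∂ⱼP`,
`h = ∑ᵢⱼ|∂ᵢ∂ⱼP|`, smooth `P`, real `q ≥ 2`. [ours] -/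
theorem abs_pressure_production_le {v : UnitAddTorus d → EuclideanSpace ℝ d} (hv : IsSmooth v)
    {P : UnitAddTorus d → ℝ} (hP : IsSmooth P) {q : ℝ} (hq : 2 ≤ q) :
    |∫ x, torusStrainSqAt v x ^ (q / 2 - 1) * ∑ i, ∑ j,
        (partialDeriv j v x i + partialDeriv i v x j) / 2 * partialDeriv i (partialDeriv j P) x| ≤
      ∫ x, ‖strainFlat v x‖ ^ (q - 1) * ∑ i, ∑ j, |partialDeriv i (partialDeriv j P) x| :=
  abs_integral_rpow_mul_le hv (continuous_hessAbs hP)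
    (fun x => abs_sum_strain_mul_le_sum_abs v x fun i j => partialDeriv i (partialDeriv j P) x) hq

/-! ## 2. Hölder -/

omit [DecidableEq d] in
/-- **Hölder**: `∫ φ^{q−1} G ≤ (∫ φ^q)^{(q−1)/q} (∫ G^q)^{1/q}` for continuous `φ, G ≥ 0` and real
`q > 1`. [folklore] -/
theorem integral_rpow_mul_le_holder {φ G : UnitAddTorus d → ℝ} (hφ : Continuous φ)
    (hG : Continuous G) (hφ0 : ∀ x, 0 ≤ φ x) (hG0 : ∀ x, 0 ≤ G x) {q : ℝ} (hq : 1 < q) :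
    ∫ x, φ x ^ (q - 1) * G x ≤ (∫ x, φ x ^ q) ^ ((q - 1) / q) * (∫ x, G x ^ q) ^ (1 / q) := by
  have hq0 : 0 < q := by linarith
  have hq0' : q ≠ 0 := hq0.ne'
  have hq1' : q - 1 ≠ 0 := by
    intro h; linarith
  have ha : 0 < (q - 1) / q := div_pos (by linarith) hq0
  have hb : 0 < 1 / q := div_pos one_pos hq0
  have hab : (q - 1) / q + 1 / q = 1 := by field_simp; ring
  have h := integral_mul_le_rpow_mul_rpow (hφ.rpow_const fun _ => Or.inr (by linarith : 0 ≤ q - 1))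
    hG (fun x => Real.rpow_nonneg (hφ0 x) _) hG0 ha hb hab
  have e1 : ∀ x, (φ x ^ (q - 1)) ^ ((q - 1) / q)⁻¹ = φ x ^ q := by
    intro x
    rw [← Real.rpow_mul (hφ0 x)]
    congr 1
    field_simp
  have e2 : ∀ x, G x ^ (1 / q)⁻¹ = G x ^ q := fun x => by rw [one_div, inv_inv]
  simp only [e1, e2] at h
  exact h

/-! ## 3. Calderón–Zygmund in real-power form -/

/-- **Strain Calderón–Zygmund at `s = 2q`, real powers.** For real `q > 1/2` there is `K ≥ 0` with
`∫ (∑ₖ‖∂ₖv‖²)^q ≤ K ∫ ‖strainFlat v‖^{2q}` for every smooth divergence-free `v : T³ → ℝ³`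
(`StrainTensor.exists_gradLs_le_strainLs` at `s = 2q`, raised to the power `2q`).
[cite: Miller2019, §3 (before Prop. 3.1: the strain-to-gradient operator is Calderón–Zygmund bounded on L^p, 1 < p < ∞)] -/
theorem exists_cz_rpow {q : ℝ} (hq : 1 / 2 < q) :
    ∃ K : ℝ, 0 ≤ K ∧ ∀ v : UnitAddTorus (Fin 3) → EuclideanSpace ℝ (Fin 3), IsSmooth v →
      IsDivFree v →
      ∫ x, (∑ k, ‖partialDeriv k v x‖ ^ 2) ^ q ≤ K * ∫ x, ‖strainFlat v x‖ ^ (2 * q) := by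
  have hs : 1 < 2 * q := by linarith
  have hs0 : 0 < 2 * q := by linarith
  obtain ⟨K, hK0, hK⟩ := StrainTensor.exists_gradLs_le_strainLs (s := 2 * q) hs
  refine ⟨K ^ (2 * q), Real.rpow_nonneg hK0 _, fun v hv hdiv => ?_⟩
  have h := hK v hv hdiv
  have hg0 : ∀ x, 0 ≤ ∑ k, ‖partialDeriv k v x‖ ^ 2 := fun x =>
    Finset.sum_nonneg fun k _ => sq_nonneg _
  have e1 : ∫ x, Real.sqrt (∑ j, ‖partialDeriv j v x‖ ^ 2) ^ (2 * q) =
      ∫ x, (∑ k, ‖partialDeriv k v x‖ ^ 2) ^ q :=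
    integral_congr_ae (ae_of_all _ fun x => by
      show Real.sqrt (∑ j, ‖partialDeriv j v x‖ ^ 2) ^ (2 * q) = (∑ k, ‖partialDeriv k v x‖ ^ 2) ^ q
      rw [Real.sqrt_eq_rpow, ← Real.rpow_mul (hg0 x)]
      congr 1; ring)
  have e2 : ∫ x, Real.sqrt (torusStrainSqAt v x) ^ (2 * q) = ∫ x, ‖strainFlat v x‖ ^ (2 * q) :=
    integral_congr_ae (ae_of_all _ fun x => by
      show Real.sqrt (torusStrainSqAt v x) ^ (2 * q) = ‖strainFlat v x‖ ^ (2 * q)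
      rw [norm_strainFlat_eq_sqrt])
  rw [e1, e2] at h
  obtain ⟨G, hG⟩ : ∃ G : ℝ, G = ∫ x, (∑ k, ‖partialDeriv k v x‖ ^ 2) ^ q := ⟨_, rfl⟩
  obtain ⟨A, hA⟩ : ∃ A : ℝ, A = ∫ x, ‖strainFlat v x‖ ^ (2 * q) := ⟨_, rfl⟩
  rw [← hG, ← hA] at h ⊢
  have hG0 : 0 ≤ G := by rw [hG]; exact integral_nonneg fun x => Real.rpow_nonneg (hg0 x) _
  have hA0 : 0 ≤ A := by rw [hA]; exact integral_nonneg fun x => Real.rpow_nonneg (norm_nonneg _) _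
  have h2 := Real.rpow_le_rpow (Real.rpow_nonneg hG0 _) h hs0.le
  rw [← Real.rpow_mul hG0, Real.mul_rpow hK0 (Real.rpow_nonneg hA0 _), ← Real.rpow_mul hA0,
    show 1 / (2 * q) * (2 * q) = 1 by field_simp, Real.rpow_one, Real.rpow_one] at h2
  exact h2

/-- **Pressure-Hessian Calderón–Zygmund at a real exponent, `q`-th power form.** For real `q > 1`
there is `C ≥ 0` with `∫|∂ᵢ∂ⱼp|^q ≤ C ∫(∑ₖ‖∂ₖu‖²)^q` along every classical solution of unforced
Navier–Stokes on `T^d` (`Torus.exists_pressureHessian_Ls_le_gradSq` raised to the power `q`).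
[cite: RobinsonRodrigoSadowski2016, Thm B.7 and Ch. 5 (5.3)] -/
theorem exists_hess_rpow {q : ℝ} (hq : 1 < q) :
    ∃ C : ℝ, 0 ≤ C ∧ ∀ {a b ν : ℝ}, a < b →
      ∀ {u : ℝ → UnitAddTorus d → EuclideanSpace ℝ d} {p : ℝ → UnitAddTorus d → ℝ},
        IsClassicalNSSolutionOn (Icc a b) ν 0 u p → ∀ t ∈ Icc a b, ∀ i j : d,
          ∫ x, |partialDeriv i (partialDeriv j (p t)) x| ^ q ≤
            C * ∫ x, (∑ k, ‖partialDeriv k (u t) x‖ ^ 2) ^ q := by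
  have hq0 : 0 < q := by linarith
  obtain ⟨C, hC0, hC⟩ := Torus.exists_pressureHessian_Ls_le_gradSq (d := d) hq
  refine ⟨C ^ q, Real.rpow_nonneg hC0 _, fun {a b ν} hab {u p} hsol t ht i j => ?_⟩
  have h := hC hab hsol t ht i j
  obtain ⟨H, hH⟩ : ∃ H : ℝ, H = ∫ x, |partialDeriv i (partialDeriv j (p t)) x| ^ q := ⟨_, rfl⟩
  obtain ⟨G, hG⟩ : ∃ G : ℝ, G = ∫ x, (∑ k, ‖partialDeriv k (u t) x‖ ^ 2) ^ q := ⟨_, rfl⟩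
  rw [← hH, ← hG] at h ⊢
  have hH0 : 0 ≤ H := by rw [hH]; exact integral_nonneg fun x => Real.rpow_nonneg (abs_nonneg _) _
  have hG0 : 0 ≤ G := by
    rw [hG]; exact integral_nonneg fun x => Real.rpow_nonneg (Finset.sum_nonneg fun k _ => sq_nonneg _) _
  have h2 := Real.rpow_le_rpow (Real.rpow_nonneg hH0 _) h hq0.le
  rw [← Real.rpow_mul hH0, Real.mul_rpow hC0 (Real.rpow_nonneg hG0 _), ← Real.rpow_mul hG0,
    show 1 / q * q = 1 by field_simp, Real.rpow_one, Real.rpow_one] at h2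
  exact h2

omit [DecidableEq d] in
/-- **Power mean at a real exponent**: `∫ (∑ᵢⱼ|Hᵢⱼ|)^q ≤ (#d²)^{q−1} ∑ᵢⱼ ∫|Hᵢⱼ|^q` for continuous
entries and real `q ≥ 1`. [folklore] -/
theorem integral_sum_abs_rpow_le {H : d → d → UnitAddTorus d → ℝ} (hH : ∀ i j, Continuous (H i j))
    {q : ℝ} (hq : 1 ≤ q) :
    ∫ x, (∑ i, ∑ j, |H i j x|) ^ q ≤
      ((Fintype.card d : ℝ) ^ 2) ^ (q - 1) * ∑ i, ∑ j, ∫ x, |H i j x| ^ q := by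
  have hpt : ∀ x, (∑ i, ∑ j, |H i j x|) ^ q ≤
      ((Fintype.card d : ℝ) ^ 2) ^ (q - 1) * ∑ i, ∑ j, |H i j x| ^ q := by
    intro x
    have h := Real.rpow_sum_le_const_mul_sum_rpow_of_nonneg (s := (Finset.univ : Finset (d × d)))
      (f := fun r : d × d => |H r.1 r.2 x|) hq (fun r _ => abs_nonneg _)
    rw [Fintype.sum_prod_type, Fintype.sum_prod_type, Finset.card_univ, Fintype.card_prod] at h
    have e : ((Fintype.card d * Fintype.card d : ℕ) : ℝ) = (Fintype.card d : ℝ) ^ 2 := by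
      push_cast; ring
    rw [e] at h
    exact h
  have hi : ∀ i j, Integrable (fun x => |H i j x| ^ q) := fun i j =>
    ((hH i j).abs.rpow_const fun _ => Or.inr (by linarith)).integrable_unitAddTorus
  calc ∫ x, (∑ i, ∑ j, |H i j x|) ^ q
      ≤ ∫ x, ((Fintype.card d : ℝ) ^ 2) ^ (q - 1) * ∑ i, ∑ j, |H i j x| ^ q := by
        refine integral_mono_of_nonneg (ae_of_all _ fun x => ?_) ?_ (ae_of_all _ hpt)
        · exact Real.rpow_nonneg
            (Finset.sum_nonneg fun i _ => Finset.sum_nonneg fun j _ => abs_nonneg _) _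
        · exact (integrable_finsetSum _ fun i _ => integrable_finsetSum _ fun j _ => hi i j).const_mul _
    _ = ((Fintype.card d : ℝ) ^ 2) ^ (q - 1) * ∑ i, ∑ j, ∫ x, |H i j x| ^ q := by
        rw [integral_const_mul, integral_finsetSum _ fun i _ =>
          integrable_finsetSum _ fun j _ => hi i j]
        congr 1
        exact Finset.sum_congr rfl fun i _ => integral_finsetSum _ fun j _ => hi i j

/-! ## 4. Cauchy–Schwarz and the outward interpolation for a continuous field -/

omit [DecidableEq d] in
/-- **`(∫‖w‖^{2q})² ≤ (∫‖w‖^q)(∫‖w‖^{3q})`** for real `q > 0` and continuous `w` (Cauchy–Schwarz with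
`‖w‖^{q/2}·‖w‖^{3q/2}`). [folklore] -/
theorem moment_two_q_sq_le {F : Type*} [NormedAddCommGroup F] {w : UnitAddTorus d → F}
    (hw : Continuous w) {q : ℝ} (hq : 0 < q) :
    (∫ x, ‖w x‖ ^ (2 * q)) ^ 2 ≤ (∫ x, ‖w x‖ ^ q) * ∫ x, ‖w x‖ ^ (3 * q) := by
  have h := sq_integral_mul_le (f := fun x => ‖w x‖ ^ (q / 2)) (g := fun x => ‖w x‖ ^ (3 * q / 2))
    (VelocityMoment.continuous_norm_rpow' hw (by positivity)) (VelocityMoment.continuous_norm_rpow' hw (by positivity))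
  have e1 : ∀ x, ‖w x‖ ^ (q / 2) * ‖w x‖ ^ (3 * q / 2) = ‖w x‖ ^ (2 * q) := fun x => by
    rw [← Real.rpow_add' (norm_nonneg _) (by linarith : (0 : ℝ) < q / 2 + 3 * q / 2).ne']
    congr 1; ring
  have e2 : ∀ x, (‖w x‖ ^ (q / 2)) ^ 2 = ‖w x‖ ^ q := fun x => by
    rw [← Real.rpow_natCast, ← Real.rpow_mul (norm_nonneg _)]; congr 1; push_cast; ring
  have e3 : ∀ x, (‖w x‖ ^ (3 * q / 2)) ^ 2 = ‖w x‖ ^ (3 * q) := fun x => by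
    rw [← Real.rpow_natCast, ← Real.rpow_mul (norm_nonneg _)]; congr 1; push_cast; ring
  simp only [e1, e2, e3] at h
  exact h

omit [DecidableEq d] in
/-- **Outward (Lyapunov) interpolation** `∫‖w‖^q ≤ (∫‖w‖²)^θ (∫‖w‖^{3q})^{1−θ}`, `θ = 2q/(3q−2)`,
for real `q > 2` and continuous `w` (Hölder with weights `θ, 1−θ`; `2θ + 3q(1−θ) = q`). [folklore] -/
theorem moment_q_le_interp {F : Type*} [NormedAddCommGroup F] {w : UnitAddTorus d → F}
    (hw : Continuous w) {q : ℝ} (hq : 2 < q) :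
    ∫ x, ‖w x‖ ^ q ≤
      (∫ x, ‖w x‖ ^ (2 : ℝ)) ^ (2 * q / (3 * q - 2)) *
        (∫ x, ‖w x‖ ^ (3 * q)) ^ (1 - 2 * q / (3 * q - 2)) := by
  obtain ⟨θ, hθ⟩ : ∃ θ : ℝ, θ = 2 * q / (3 * q - 2) := ⟨_, rfl⟩
  have h3q : 0 < 3 * q - 2 := by linarith
  have h3q' : 3 * q - 2 ≠ 0 := h3q.ne'
  have hθ0 : 0 < θ := by rw [hθ]; exact div_pos (by linarith) h3q
  have hθ1 : θ < 1 := by rw [hθ, div_lt_one h3q]; linarith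
  have hθ1' : 0 < 1 - θ := by linarith
  have hθ0' : θ ≠ 0 := hθ0.ne'
  have hθ1'' : 1 - θ ≠ 0 := hθ1'.ne'
  rw [← hθ]
  have h := integral_mul_le_rpow_mul_rpow
    (f := fun x => ‖w x‖ ^ (2 * θ)) (g := fun x => ‖w x‖ ^ (3 * q * (1 - θ)))
    (VelocityMoment.continuous_norm_rpow' hw (by positivity)) (VelocityMoment.continuous_norm_rpow' hw (by positivity))
    (fun x => Real.rpow_nonneg (norm_nonneg _) _) (fun x => Real.rpow_nonneg (norm_nonneg _) _)
    hθ0 hθ1' (by ring)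
  have hθ' : θ * (3 * q - 2) = 2 * q := by rw [hθ, div_mul_cancel₀ _ h3q']
  have hexp : 2 * θ + 3 * q * (1 - θ) = q := by linear_combination (-1 : ℝ) * hθ'
  have e1 : ∀ x, ‖w x‖ ^ (2 * θ) * ‖w x‖ ^ (3 * q * (1 - θ)) = ‖w x‖ ^ q := fun x => by
    rw [← Real.rpow_add' (norm_nonneg _) (by rw [hexp]; linarith), hexp]
  have e2 : ∀ x, (‖w x‖ ^ (2 * θ)) ^ θ⁻¹ = ‖w x‖ ^ (2 : ℝ) := fun x => by
    rw [← Real.rpow_mul (norm_nonneg _)]; congr 1; field_simp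
  have e3 : ∀ x, (‖w x‖ ^ (3 * q * (1 - θ))) ^ (1 - θ)⁻¹ = ‖w x‖ ^ (3 * q) := fun x => by
    rw [← Real.rpow_mul (norm_nonneg _)]; congr 1; field_simp
  simp only [e1, e2, e3] at h
  exact h

end StrainMoment

end Summit.NavierStokesRegularity.FunctionalMining
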